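import Literature.NumberTheory.Rogawski1990.StableClassTransferMap
import Literature.LinearAlgebra.Matrix.HermitianCongruenceInertia
import HarnessLib

/-!
# The range of the transfer map `𝒪′_st ↦ 𝒪_st` of stable classes `U(H)(L⁺) → U(Φ₃)(L⁺)`: occurring classes are COMPACT at the places where `H` is
# definite; in particular the map is NOT surjective once `H` is definite at some complex embedding (Rogawski 1990, §14.1–14.2)

Topic `NumberTheory/Rogawski1990`; namespace `Literature.NumberTheory.Rogawski1990`; THEOREMS ONLY (no def, no named fact, no instance, no notation),
on top of ★ `StableClassTransferMap` (T1b-2: `stableClassTransfer`, `charpoly_stableClassTransfer`), ★ `StableConjugacyU3` and ★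
`Literature.LinearAlgebra.Matrix.map_transpose_map_eq_conjTranspose` (`HermitianCongruenceInertia`).

[Rogawski1990, §14.1 p. 232]: «If `γ ∈ G`, we will say that `γ` occurs in `G′` if `γ′ ↔ γ` for some `γ′ ∈ G′`»; [§14.2 p. 232–233]: «Let `S₀` be the
set of infinite places `v` of `F` such that `G′_v` is isomorphic to `U₃(ℝ)` … `Φ^st(γ, f_v) = 0` if `γ` does not occur in `G′`» (14.2.1).  WHY such
`γ` exist: at a complex embedding `τ` where `H` is positive definite, every `γ′ ∈ U(H)(L⁺)` is «compact» — all roots of its characteristic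
polynomial under `τ` have absolute value `1` (`norm_eq_one_of_isRoot_charpoly_of_posDef`), and corresponding elements share characteristic
polynomials; whereas the split torus of the quasi-split `U(Φ₃)` contains `diag(2, 1, (c 2)⁻¹)` with the root `τ 2 = 2`.

* `norm_eq_one_of_isRoot_charpoly_of_posDef` — `γ′ ∈ U(H)(L⁺)`, `(H.map τ).PosDef`, `μ` a root of `τ(charpoly γ′)` ⇒ `‖μ‖ = 1`;
* `norm_eq_one_of_mem_range_stableClassTransfer` — the same for every class in `Set.range (stableClassTransfer L H)` (necessity half of the
  occurrence criterion «compact at the definite places»);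
* `exists_mem_unitaryGroup_antidiagThree_isRoot_two` — `diag(2, 1, (c 2)⁻¹) ∈ U(Φ₃)(L⁺)` has characteristic root `2`;
* **`not_surjective_stableClassTransfer_of_posDef_map`** — if `H.map τ` is positive definite for some `τ` then `stableClassTransfer L H` is not
  surjective: some stable class of `U(Φ₃)(L⁺)` does not occur in `U(H)(L⁺)` — so sums over the classes of the quasi-split group must be indexed
  with print's «0 otherwise» (★ `transferFun`), not by silent surjectivity.
-/

noncomputable section

namespace Literature.NumberTheory.Rogawski1990

open scoped MatrixGroups Matrix ComplexOrder
open NumberField Polynomial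
open Literature.AlgebraicGeometry.ShimuraVarieties (unitaryGroup mem_unitaryGroup_iff)
open Literature.NumberTheory.Automorphic (cmConjRingHom cmConjRingHom_apply embedding_cmConjRingHom)
open Literature.NumberTheory.QuadraticForms.Landherr (conjTranspose)

variable (L : Type) [Field L] [NumberField L] [IsCMField L]

/-! ## §1 Elements of a definite unitary group are compact: characteristic roots of absolute value `1` -/

/-- A root of the characteristic polynomial of `G ∈ M_n(ℂ)` has an eigenvector. [folklore] -/
private theorem exists_eigenvector_of_isRoot {n : Type} [Fintype n] [DecidableEq n] (G : Matrix n n ℂ) {μ : ℂ} (hμ : G.charpoly.IsRoot μ) :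
    ∃ v : n → ℂ, v ≠ 0 ∧ G *ᵥ v = μ • v := by
  rw [Polynomial.IsRoot, Matrix.eval_charpoly] at hμ
  obtain ⟨v, hv, hGv⟩ := Matrix.exists_mulVec_eq_zero_iff.mpr hμ
  refine ⟨v, hv, ?_⟩
  rw [Matrix.sub_mulVec, sub_eq_zero, Matrix.scalar_apply, Matrix.diagonal_const_mulVec] at hGv
  exact hGv.symm

/-- Unitarity seen at a complex embedding: `(τγ)ᴴ · τH · τγ = τH` for `γ ∈ U(H)(L⁺)` (`τ ∘ c = conj ∘ τ`). [cite: Rogawski1990, §1.9] -/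
theorem conjTranspose_map_mul_map_mul_map {N : ℕ} {H : Matrix (Fin N) (Fin N) L} (γ : unitaryGroup (cmConjRingHom L) H) (τ : L →+* ℂ) :
    (((γ : GL (Fin N) L) : Matrix (Fin N) (Fin N) L).map τ)ᴴ * H.map τ * ((γ : GL (Fin N) L) : Matrix (Fin N) (Fin N) L).map τ = H.map τ := by
  have h := congrArg (fun M : Matrix (Fin N) (Fin N) L => M.map τ) (mem_unitaryGroup_iff.mp γ.2)
  simp only [Matrix.map_mul] at h
  rwa [Literature.LinearAlgebra.Matrix.map_transpose_map_eq_conjTranspose τ (cmConjRingHom L) (embedding_cmConjRingHom L τ)] at h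

/-- **Elements of a DEFINITE unitary group are compact**: if `H.map τ` is positive definite, every root `μ` of `τ(charpoly γ′)`, `γ′ ∈ U(H)(L⁺)`, has
`‖μ‖ = 1` (an eigenvector `v` gives `v^*Av · (‖μ‖² − 1) = 0` with `v^*Av > 0`). [cite: Rogawski1990, §14.2 p. 232] -/
theorem norm_eq_one_of_isRoot_charpoly_of_posDef {N : ℕ} {H : Matrix (Fin N) (Fin N) L} {τ : L →+* ℂ} (hτ : (H.map τ).PosDef)
    (γ : unitaryGroup (cmConjRingHom L) H) {μ : ℂ} (hμ : ((((γ : GL (Fin N) L) : Matrix (Fin N) (Fin N) L).charpoly).map τ).IsRoot μ) :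
    ‖μ‖ = 1 := by
  set G : Matrix (Fin N) (Fin N) ℂ := ((γ : GL (Fin N) L) : Matrix (Fin N) (Fin N) L).map τ with hG
  set A : Matrix (Fin N) (Fin N) ℂ := H.map τ with hA
  rw [← Matrix.charpoly_map] at hμ
  obtain ⟨v, hv, hGv⟩ := exists_eigenvector_of_isRoot G hμ
  -- `v^* A v = (Gv)^* A (Gv) = ‖μ‖² · v^* A v`
  have hunit : Gᴴ * A * G = A := conjTranspose_map_mul_map_mul_map L γ τ
  have hq : star v ⬝ᵥ A *ᵥ v = (starRingEnd ℂ μ * μ) * (star v ⬝ᵥ A *ᵥ v) := by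
    conv_lhs => rw [← hunit]
    rw [← Matrix.mulVec_mulVec, ← Matrix.mulVec_mulVec, hGv, Matrix.mulVec_smul, Matrix.dotProduct_mulVec, ← Matrix.star_mulVec,
      hGv, star_smul, smul_dotProduct, dotProduct_smul, smul_eq_mul, smul_eq_mul, RCLike.star_def, mul_assoc]
  have hpos : 0 < star v ⬝ᵥ A *ᵥ v := hτ.dotProduct_mulVec_pos hv
  have hne : star v ⬝ᵥ A *ᵥ v ≠ 0 := ne_of_gt hpos
  have h1 : starRingEnd ℂ μ * μ = 1 := by
    have := hq.symm
    rw [mul_left_eq_self₀] at this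
    exact this.resolve_right hne
  have h2 : (‖μ‖ ^ 2 : ℝ) = 1 := by
    have := congrArg Complex.re h1
    rw [Complex.conj_mul', ← Complex.ofReal_pow, Complex.ofReal_re, Complex.one_re] at this
    exact this
  nlinarith [norm_nonneg μ, h2]

/-! ## §2 Occurring classes of `U(Φ₃)` are compact at the definite places; the transfer map is not surjective -/

/-- Along `γ′ ↔ γ` (★ `Corresponds`: same characteristic polynomial) compactness transfers: every root of `τ(charpoly γ)` has absolute value `1`
when `γ` corresponds to an element of the definite `U(H)`. [cite: Rogawski1990, §14.1 p. 232] -/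
theorem norm_eq_one_of_corresponds_of_posDef {N : ℕ} {H H' : Matrix (Fin N) (Fin N) L} {τ : L →+* ℂ} (hτ : (H.map τ).PosDef)
    {γ' : unitaryGroup (cmConjRingHom L) H} {γ : unitaryGroup (cmConjRingHom L) H'} (h : Corresponds (cmConjRingHom L) H H' γ' γ)
    {μ : ℂ} (hμ : ((((γ : GL (Fin N) L) : Matrix (Fin N) (Fin N) L).charpoly).map τ).IsRoot μ) : ‖μ‖ = 1 := by
  rw [← h.charpoly_eq] at hμ
  exact norm_eq_one_of_isRoot_charpoly_of_posDef L hτ γ' hμ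

/-- **The necessity half of the occurrence criterion**: a stable class of `U(Φ₃)(L⁺)` in the range of ★ `stableClassTransfer L H` (i.e. OCCURRING in
`U(H)(L⁺)`) is compact at every complex embedding `τ` where `H` is positive definite — all roots of `τ(charpoly 𝒪)` have absolute value `1`.
[cite: Rogawski1990, §14.2 p. 232] -/
theorem norm_eq_one_of_mem_range_stableClassTransfer {H : Matrix (Fin 3) (Fin 3) L} (hH : conjTranspose L H = H) (h0 : H.det ≠ 0)
    {τ : L →+* ℂ} (hτ : (H.map τ).PosDef)
    {c : StableClass (cmConjRingHom L) (Matrix.of fun i j : Fin 3 => if i.val + j.val + 1 = 3 then (1 : L) else 0)}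
    (hc : c ∈ Set.range (stableClassTransfer L H)) {μ : ℂ} (hμ : (c.charpoly.map τ).IsRoot μ) : ‖μ‖ = 1 := by
  obtain ⟨c', rfl⟩ := hc
  obtain ⟨γ', rfl⟩ := stableClassOf_surjective c'
  rw [charpoly_stableClassTransfer L H hH h0, StableClass.charpoly_stableClassOf] at hμ
  exact norm_eq_one_of_isRoot_charpoly_of_posDef L hτ γ' hμ

/-- **A non-compact element of the quasi-split group**: `diag(2, 1, (c 2)⁻¹) ∈ U(Φ₃)(L⁺)` (the split torus pairing `e₁` with `e₃`), with characteristic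
root `2`. [cite: Rogawski1990, §14.2 p. 232] -/
theorem exists_mem_unitaryGroup_antidiagThree_isRoot_two :
    ∃ γ : unitaryGroup (cmConjRingHom L) (Matrix.of fun i j : Fin 3 => if i.val + j.val + 1 = 3 then (1 : L) else 0),
      (((γ : GL (Fin 3) L) : Matrix (Fin 3) (Fin 3) L).charpoly).IsRoot 2 := by
  have h2 : (2 : L) ≠ 0 := two_ne_zero
  have hc2 : cmConjRingHom L 2 = 2 := map_ofNat _ 2
  set D : Matrix (Fin 3) (Fin 3) L := Matrix.diagonal ![2, 1, (cmConjRingHom L 2)⁻¹] with hD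
  have hdet : D.det ≠ 0 := by
    rw [hD, Matrix.det_diagonal, Fin.prod_univ_three]
    simp [hc2, h2]
  have hmem : Matrix.GeneralLinearGroup.mkOfDetNeZero D hdet ∈
      unitaryGroup (cmConjRingHom L) (Matrix.of fun i j : Fin 3 => if i.val + j.val + 1 = 3 then (1 : L) else 0) := by
    rw [mem_unitaryGroup_iff]
    change ((D.map (cmConjRingHom L))ᵀ * _ * D) = _
    ext i j
    fin_cases i <;> fin_cases j <;>
      simp [hD, Matrix.mul_apply, Fin.sum_univ_three, Matrix.diagonal, Matrix.of_apply, hc2, h2, map_one]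
  refine ⟨⟨Matrix.GeneralLinearGroup.mkOfDetNeZero D hdet, hmem⟩, ?_⟩
  change (D.charpoly).IsRoot 2
  rw [hD, Matrix.charpoly_diagonal, Polynomial.IsRoot, Polynomial.eval_prod, Fin.prod_univ_three]
  simp

/-- **`stableClassTransfer L H` is NOT surjective when `H` is definite at some complex embedding** (the engine's `H`: signature `(2,1)` at one real place,
definite at the `d − 1 ≥ 1` others): the class of `diag(2, 1, (c 2)⁻¹)` does not occur in `U(H)(L⁺)`.  Hence sums over the stable classes of
`U(Φ₃)(L⁺)` must be indexed with print's «`0` otherwise» (★ `StableClass.transferFun`, ★ `transferFun_eq_zero_of_not_mem_range`).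
[cite: Rogawski1990, §14.2 p. 232] -/
theorem not_surjective_stableClassTransfer_of_posDef_map {H : Matrix (Fin 3) (Fin 3) L} (hH : conjTranspose L H = H) (h0 : H.det ≠ 0)
    {τ : L →+* ℂ} (hτ : (H.map τ).PosDef) : ¬ Function.Surjective (stableClassTransfer L H) := by
  intro hsurj
  obtain ⟨γ, hγ⟩ := exists_mem_unitaryGroup_antidiagThree_isRoot_two L
  have hroot : (((stableClassOf (cmConjRingHom L) _ γ).charpoly).map τ).IsRoot (τ 2) := by
    rw [StableClass.charpoly_stableClassOf]
    exact Polynomial.IsRoot.map hγ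
  have h := norm_eq_one_of_mem_range_stableClassTransfer L hH h0 hτ (hsurj.range_eq ▸ Set.mem_univ _) hroot
  rw [map_ofNat, RCLike.norm_ofNat] at h
  norm_num at h

/-- Equivalently: some stable class of `U(Φ₃)(L⁺)` does NOT occur in `U(H)(L⁺)` (★ `OccursIn`). [cite: Rogawski1990, §14.2 p. 232] -/
theorem exists_not_occursIn_of_posDef_map {H : Matrix (Fin 3) (Fin 3) L} (hH : conjTranspose L H = H) (h0 : H.det ≠ 0) {τ : L →+* ℂ}
    (hτ : (H.map τ).PosDef) :
    ∃ c : StableClass (cmConjRingHom L) (Matrix.of fun i j : Fin 3 => if i.val + j.val + 1 = 3 then (1 : L) else 0), ¬ c.OccursIn H := by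
  by_contra hall
  push Not at hall
  exact not_surjective_stableClassTransfer_of_posDef_map L hH h0 hτ fun c =>
    mem_range_stableClassTransfer_of_occursIn L (hall c)

end Literature.NumberTheory.Rogawski1990
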